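import Summits.CriticalPhenomena.PercolationContinuityZ3.Theorems.Transplant.SkelTubeLevels
import HarnessLib

/-!
# L5.2 (generic design-(D) re-typing) — restricting a weighting of `G` to the pairs of a graph ball: a subbox weighting of `G` that
# charges only edges becomes a subbox weighting of the WINDOW graph `winGraph G w₀ R` (SHEAR-SCOPE §3.9 L5.2; src
# `BoxProdZ2TubeRestrict.lean`, the transfer the corridor chain needs to run in the window graph)

builds on p205010 (kernel theorem, internal audit signed; external expert review pending) — nothing in this file uses p205010.
Lane `prim-bschramm`, seat `prim-bschramm-p1` (gen 7); helper file (`--supports stmt-CriticalPhenomena-4575 --as helper`).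
Constructor substitution of p3's `BoxProdZ2TubeRestrict` along SHEAR-SCOPE §3.1 (`π × ℤ²` ↦ `B_G(w₀, R)`, `tubeGraph X π` ↦ `winGraph G w₀ R`);
everything here is `Φ`-free (pure graph-ball geometry of `G`).

* `winRestrict G w₀ R Wt` — the weighting `Wt` on the pairs with both endpoints in `B_G(w₀, R)`, `0` elsewhere; `winRestrict_le` (pointwise `≤ Wt`);
* **`isSubbox_winRestrict`** — if `Wt` is a subbox weighting of `G` on `D ⊆ B_G(w₀, R)` (`KNLevels.IsSubbox`) and charges only edges of `G`
  (`EdgeSupp`), then `winRestrict G w₀ R Wt` is a subbox weighting of `winGraph G w₀ R` on `D` — the hypothesis `hsub` of `Skel.lhyp_win`;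
* `finSupp_winRestrict` — finite support is inherited; `winRestrict_eq_of_mem` (inside the ball nothing changes).

[cite: KozmaNitzan2024, §4 p. 17 (subbox) — the ℤ^d model]
-/

noncomputable section

open scoped Classical

namespace Summit.CriticalPhenomena.PercolationContinuityZ3.Theorems

namespace Transplant

namespace Skel

open Literature.Probability.Percolation Literature.Probability.LatticeModels SimpleGraph KNLevels
open Literature.Barriers.CriticalPhenomena (graphBall)

variable {V : Type} (G : SimpleGraph V)

/-- **The restriction of a weighting to the pairs of the ball `B_G(w₀, R)`.** Generic twin of `BoxProdZ2.tubeRestrict`. [folklore] -/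
def winRestrict (w₀ : V) (R : ℕ) (Wt : Sym2 V → unitInterval) : Sym2 V → unitInterval :=
  fun e => if ∀ z ∈ e, z ∈ graphBall G w₀ R then Wt e else 0

/-- The restricted weighting on a pair, unfolded. [folklore] -/
theorem winRestrict_mk (w₀ : V) (R : ℕ) (Wt : Sym2 V → unitInterval) (x y : V) :
    winRestrict G w₀ R Wt s(x, y) = if x ∈ graphBall G w₀ R ∧ y ∈ graphBall G w₀ R then Wt s(x, y) else 0 := by
  unfold winRestrict
  by_cases h : x ∈ graphBall G w₀ R ∧ y ∈ graphBall G w₀ R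
  · rw [if_pos h, if_pos]; intro z hz; rcases Sym2.mem_iff.1 hz with rfl | rfl; exacts [h.1, h.2]
  · rw [if_neg h, if_neg]; intro h'; exact h ⟨h' x (Sym2.mem_mk_left x y), h' y (Sym2.mem_mk_right x y)⟩

/-- Inside the ball the restriction is the weighting. [folklore] -/
theorem winRestrict_mk_of_mem {w₀ : V} {R : ℕ} (Wt : Sym2 V → unitInterval) {x y : V} (hx : x ∈ graphBall G w₀ R)
    (hy : y ∈ graphBall G w₀ R) : winRestrict G w₀ R Wt s(x, y) = Wt s(x, y) := by
  rw [winRestrict_mk, if_pos ⟨hx, hy⟩]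

/-- The restriction is pointwise below the weighting. [folklore] -/
theorem winRestrict_le (w₀ : V) (R : ℕ) (Wt : Sym2 V → unitInterval) (e : Sym2 V) : winRestrict G w₀ R Wt e ≤ Wt e := by
  unfold winRestrict; split_ifs
  · exact le_rfl
  · exact bot_le

/-- The restriction vanishes on pairs with an endpoint off the ball. [folklore] -/
theorem winRestrict_eq_zero_of_not_mem {w₀ : V} {R : ℕ} (Wt : Sym2 V → unitInterval) {e : Sym2 V} {z : V} (hz : z ∈ e)
    (hzR : z ∉ graphBall G w₀ R) : winRestrict G w₀ R Wt e = 0 := by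
  unfold winRestrict
  rw [if_neg]
  exact fun h => hzR (h z hz)

/-- **Edge-supported weighting**: only edges of `G` carry weight (true for every weighting built from `lattW` by restriction, pinning
on edges and wiring of edges). Generic twin of `BoxProdZ2.EdgeSupp`. [folklore] -/
def EdgeSupp (Wt : Sym2 V → unitInterval) : Prop := ∀ e, Wt e ≠ 0 → e ∈ G.edgeSet

/-- The graph weighting `lattW G p` is edge-supported. [folklore] -/
theorem edgeSupp_lattW (p : unitInterval) : EdgeSupp G (lattW G p) := by
  intro e he
  by_contra h
  exact he (by rw [lattW_apply, if_neg h])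

/-- A weighting pointwise below an edge-supported weighting (e.g. a restriction) is edge-supported. [folklore] -/
theorem EdgeSupp.of_le {Wt Wt' : Sym2 V → unitInterval} (h : EdgeSupp G Wt) (hle : ∀ e, Wt' e ≤ Wt e) : EdgeSupp G Wt' := by
  intro e he
  refine h e fun h0 => he (le_antisymm ?_ bot_le)
  exact (hle e).trans_eq h0

/-- The restriction of an edge-supported weighting is edge-supported. [folklore] -/
theorem edgeSupp_winRestrict {Wt : Sym2 V → unitInterval} (h : EdgeSupp G Wt) (w₀ : V) (R : ℕ) :
    EdgeSupp G (winRestrict G w₀ R Wt) :=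
  h.of_le G (winRestrict_le G w₀ R Wt)

variable [G.LocallyFinite]

/-- **Subbox weightings of `G` restrict to subbox weightings of the window graph** on regions inside the ball: pairs reaching an
interior vertex of `D` from a ball vertex outside `D` would be window-graph edges into `D`, contradicting interiority; pairs from off the
ball are cut. Generic twin of `BoxProdZ2.isSubbox_tubeRestrict`. [cite: KozmaNitzan2024, §4 p. 17 (subbox)] -/
theorem isSubbox_winRestrict {w₀ : V} {R : ℕ} {Wt : Sym2 V → unitInterval} {p : unitInterval} {D : Finset V}
    (h : IsSubbox G Wt p D) (hE : EdgeSupp G Wt) (hD : ∀ v ∈ D, v ∈ graphBall G w₀ R) :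
    IsSubbox (winGraph G w₀ R) (winRestrict G w₀ R Wt) p D where
  adj u hu v hv huv := by
    rw [winRestrict_mk, if_pos ⟨hD u hu, hD v hv⟩]
    exact h.adj u hu v hv ((winGraph_adj G).1 huv).1
  nadj u hu v hv hne huv := by
    rw [winRestrict_mk, if_pos ⟨hD u hu, hD v hv⟩]
    exact h.nadj u hu v hv hne fun h' => huv ((winGraph_adj G).2 ⟨h', hD u hu, hD v hv⟩)
  outside v hv hvb x hx := by
    rw [winRestrict_mk]
    split_ifs with hπ
    · -- `x` lies in the ball: if `s(x, v)` were an edge, `x` would be a window-neighbour of the interior vertex `v`, hence in `D`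
      by_contra hne
      have hedge := hE _ hne
      rw [SimpleGraph.mem_edgeSet] at hedge
      apply hvb
      rw [mem_innerBoundary_iff]
      exact ⟨hv, x, hx, (winGraph_adj G).2 ⟨hedge.symm, hπ.2, hπ.1⟩⟩
    · rfl

omit [G.LocallyFinite] in
/-- Finite support is inherited by the restriction. [folklore] -/
theorem finSupp_winRestrict {w₀ : V} {R : ℕ} {Wt : Sym2 V → unitInterval} {Sfin : Finset V} (h : FinSupp Wt Sfin) :
    FinSupp (winRestrict G w₀ R Wt) Sfin := by
  refine ⟨fun e he => ?_⟩
  have := h.zero e he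
  unfold winRestrict; split_ifs
  · exact this
  · rfl

/-- **The graph weighting restricts to a subbox weighting of the window graph on the whole window**: for `D ⊆ B_G(w₀, R)` whose
window-graph inner boundary contains every vertex of `D` with a `G`-neighbour in the ball outside `D` — in particular `D = Win w₀ P R` —
`winRestrict G w₀ R (lattW G p)` is a subbox of `winGraph G w₀ R` on `D` (the basic instance: no pinning, no wiring). [cite: KozmaNitzan2024, §4 p. 17 (subbox)] -/
theorem isSubbox_winRestrict_lattW {w₀ : V} {R : ℕ} (p : unitInterval) {D : Finset V} (hD : ∀ v ∈ D, v ∈ graphBall G w₀ R) :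
    IsSubbox (winGraph G w₀ R) (winRestrict G w₀ R (lattW G p)) p D where
  adj u hu v hv huv := by
    rw [winRestrict_mk, if_pos ⟨hD u hu, hD v hv⟩]
    exact lattW_mk_of_adj G p ((winGraph_adj G).1 huv).1
  nadj u hu v hv hne huv := by
    rw [winRestrict_mk, if_pos ⟨hD u hu, hD v hv⟩]
    exact lattW_mk_of_not_adj G p fun h' => huv ((winGraph_adj G).2 ⟨h', hD u hu, hD v hv⟩)
  outside v hv hvb x hx := by
    rw [winRestrict_mk]
    split_ifs with hπ
    · by_cases hadj : G.Adj x v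
      · exfalso
        apply hvb
        rw [mem_innerBoundary_iff]
        exact ⟨hv, x, hx, (winGraph_adj G).2 ⟨hadj.symm, hπ.2, hπ.1⟩⟩
      · exact lattW_mk_of_not_adj G p hadj
    · rfl

end Skel

end Transplant

end Summit.CriticalPhenomena.PercolationContinuityZ3.Theorems

end
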